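import Literature.MathematicalPhysics.QuantumFieldTheory.ONArchipelagoVectorTail
import Literature.MathematicalPhysics.QuantumFieldTheory.ConformalBootstrap3D.MixedOddHead
import HarnessLib

/-!
# The light vector rows of an `O(N)` archipelago point certificate from head cells

Ninth file of the archipelago rung.  The tail file (`ONArchipelagoVectorTail.lean`) closed the `V` rows
for `Δ ≥ E₀`; this one closes the LIGHT `V` rows — the items `scalar_V` (`ℓ = 0`, `Δ ∈ [Δ_V^*, E₀)`) and
`spinning_V` (every `ℓ ≥ 1`, either parity, `Δ ∈ [ℓ+1, E₀)`) of `ArchipelagoObligations` — by the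
`σ–ε` odd HEAD CELLS (`ConformalBootstrap3D/MixedOddHead.lean`) transported along the bridge
`vectorPositive_ofPoints_iff` with the odd weights `(0, 0, w₄, w₅, w₆)`: on a `Δ`-cell `[a, b)` the
head terms of the dominating evaluation `𝔇` are bounded below through the coefficient enclosures
`hrCoeffABLo/Hi` (box `c = (Δ_φ − Δ_s)/2 ∈ [c₁, c₂]`) and the two-weight corner bound with
`(w₅ − w₆ − |w₄|, w₅ + w₆ + |w₄|)`, the terms off the head set fall in the tail domain where (M_V)/(T_V)
apply, and ONE number per cell (`vectorHeadNumber ≥ 0`, = `oddHeadNumber` at the odd weights,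
`vectorHeadNumber_eq`) gives `VectorPositive` on the whole cell at every point of `Q`
(`vectorCell_of_headNumber`); cells are glued by `vectorPositive_of_cells`.

With this file the `V` sector of an archipelago point certificate is ENTIRELY closed-form (cells below
`E₀`, rules above); together with the two-sign head cells for `T`/`A` (vector rung) only the light
SINGLET `2×2` rows and the external form remain evaluator obligations.  No table, no number, no `sorry`.

Sources: arXiv:1504.07997 §2.2 (`KosPolandSimmonsDuffinVichi2015`); F. Kos, D. Poland,
D. Simmons-Duffin, JHEP 11 (2014) 109, §3.3 eq. (3.16) (`KosPolandSimmonsduffin2014`); F. A. Dolan,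
H. Osborn, Nucl. Phys. B 678 (2004) 491, §3 eq. (3.12) (`DolanOsborn2004`).
-/

noncomputable section

namespace Literature.MathematicalPhysics.QuantumFieldTheory.ONArchipelagoSystem

open Finset Set Filter Topology
open ConformalBootstrap3D (IsConformalBlock3D unitarityBound3D crossF CrossingFunctional pointFunctional
  zMono oddDomEval cornerBound₂ apexRest headSet oddHeadCellSumI oddHeadNumber oddCell_of_headNumber
  oddPositive_of_cells)

namespace ArchipelagoFunctional

/-! ### The head-cell number of a light `V` row -/

/-- **The `V` head-cell number** on the `Δ`-cell `[a, b)` of spin `ℓ` with head level `n_F`: the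
`σ–ε` odd head number at the odd weights of the point 7-vector.
[cite: KosPolandSimmonsduffin2014, §3.3 eq. (3.16)] -/
def vectorHeadNumber {n : ℕ} (z zb : Fin n → ℝ) (w : Fin 7 → Fin n → ℝ) (ℓ : ℕ)
    (c₁ c₂ a b φlo φhi : ℝ) (nF : ℕ) : ℝ :=
  oddHeadNumber z zb (oddWeights w) ℓ c₁ c₂ a b φlo φhi nF

/-- The `V` head-cell number written out: `Σ_{(n,j) ∈ headSet ℓ n_F} min(Lo·Φlo, Hi·Φlo)` with
`Φlo_{n,j} = cornerBound₂ (w₅−w₆−|w₄|) (w₅+w₆+|w₄|) j (a+n) (b+n) φ_lo φ_hi`.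
[cite: DolanOsborn2004, §3 eq. (3.12)] -/
theorem vectorHeadNumber_eq {n : ℕ} (z zb : Fin n → ℝ) (w : Fin 7 → Fin n → ℝ) (ℓ : ℕ)
    (c₁ c₂ a b φlo φhi : ℝ) (nF : ℕ) :
    vectorHeadNumber z zb w ℓ c₁ c₂ a b φlo φhi nF =
      oddHeadCellSumI ℓ c₁ c₂ a b (headSet ℓ nF) (fun q =>
        cornerBound₂ (fun k => w 5 k - w 6 k - |w 4 k|) (fun k => w 5 k + w 6 k + |w 4 k|) z zb q.2
          (a + q.1) (b + q.1) φlo φhi) := by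
  simp only [vectorHeadNumber, oddHeadNumber, oddWeights_two, oddWeights_three, oddWeights_four]

/-! ### One light `V` cell from its number -/

/-- **One light `V` cell from its number.** In the dominated configuration (apex `a₀`), for
`(Δ_φ, Δ_s) ∈ Q ⊆ [φ_lo,φ_hi] × [s_lo,s_hi]` with `(Δ_φ−Δ_s)/2 ∈ [c₁, c₂]` on `Q`, the `V` tail rules
(M_V) on `[E₀, E_T)` and (T_V) in force: a `Δ`-cell `[a, b)` starting strictly above the unitarity bound
with `a ≥ ℓ + τ` (`1 < a` or `b ≤ 1` when `ℓ = 0`), head level `n_F` with `a + n_F + 1 ≥ E₀`, and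
`vectorHeadNumber ≥ 0` give `VectorPositive` at every `Δ ∈ [a, b)`, spin `ℓ` (either parity), every
`p ∈ Q`. [cite: KosPolandSimmonsduffin2014, §3.3 eq. (3.16)] -/
theorem vectorCell_of_headNumber {n : ℕ} (z zb : Fin n → ℝ) (w : Fin 7 → Fin n → ℝ)
    (hz : ∀ k, z k ∈ Ioo (0 : ℝ) 1) (hzb : ∀ k, zb k ∈ Ioo (0 : ℝ) 1) (hord : ∀ k, zb k ≤ z k)
    (a₀ : Fin n) (qd qr : Fin n → ℝ) (hqd : ∀ k, 0 < qd k ∧ qd k ≤ 1)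
    (hqr : ∀ k, 0 < qr k ∧ qr k ≤ 1)
    (hdomd : ∀ k, z k * zb k ≤ qd k ^ 2 * (z a₀ * zb a₀) ∧ z k ≤ qd k * z a₀)
    (hdomr : ∀ k, (1 - z k) * (1 - zb k) ≤ qr k ^ 2 * (z a₀ * zb a₀) ∧ 1 - zb k ≤ qr k * z a₀)
    {Q : Set (ℝ × ℝ)} {φlo φhi slo shi c₁ c₂ E₀ ET τ : ℝ}
    (hQ : ∀ p ∈ Q, (φlo ≤ p.1 ∧ p.1 ≤ φhi) ∧ (slo ≤ p.2 ∧ p.2 ≤ shi))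
    (hQc : ∀ p ∈ Q, c₁ ≤ (p.1 - p.2) / 2 ∧ (p.1 - p.2) / 2 ≤ c₂)
    (hMV : ∀ (j : ℕ) (E : ℝ), E₀ ≤ E → E < ET → (j : ℝ) + τ ≤ E → ∀ p ∈ Q,
      0 ≤ oddDomEval z zb (oddWeights w) p.1 (zMono E j))
    (hcV : 0 ≤ w 5 a₀ - w 6 a₀ - |w 4 a₀|)
    (hTV : apexRest (w 5) z zb a₀ qd qr φlo ET + apexRest (w 6) z zb a₀ qd qr φlo ET +
        apexRest (fun k => |w 4 k|) z zb a₀ qd qr φlo ET ≤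
      (w 5 a₀ - w 6 a₀ - |w 4 a₀|) * ((1 - z a₀) * (1 - zb a₀)) ^ φhi)
    {ℓ : ℕ} {a b : ℝ} (ha : unitarityBound3D ℓ < a) (haτ : (ℓ : ℝ) + τ ≤ a)
    (h1 : ℓ = 0 → 1 < a ∨ b ≤ 1) (nF : ℕ) (hnF : E₀ ≤ a + ((nF : ℝ) + 1))
    (hnum : 0 ≤ vectorHeadNumber z zb w ℓ c₁ c₂ a b φlo φhi nF) :
    ∀ p ∈ Q, ∀ Δ ∈ Ico a b, (ofPoints z zb w).VectorPositive p.1 p.2 Δ ℓ :=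
  fun p hp Δ hΔ => (vectorPositive_ofPoints_iff z zb w p.1 p.2 Δ ℓ).2
    (oddCell_of_headNumber z zb (oddWeights w) hz hzb hord a₀ qd qr hqd hqr hdomd hdomr hQ hQc hMV
      (by simpa only [oddWeights_two, oddWeights_three, oddWeights_four] using hcV)
      (by simpa only [oddWeights_two, oddWeights_three, oddWeights_four] using hTV) ha haτ h1 nF hnF
      hnum p hp Δ hΔ)

/-! ### Light `V` rows from cell lists -/

/-- **A covered `V` range from cells.** Half-open cells `[t_i, t_{i+1})`, `i < m` (any real
breakpoints), with `t_0 ≤ lo` and `hi ≤ t_m`, each carrying `VectorPositive` on `Q`, cover every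
`Δ ∈ [lo, hi)` — the shape of the items `scalar_V` (`lo = max(Δ_V^*, 1/2)`-type ranges, `hi = E₀`) and
`spinning_V` (`lo = ℓ + 1`, `hi = E₀`). Elementary. [cite: KosPolandSimmonsduffin2014, §3.3 eq. (3.16)] -/
theorem vectorPositive_of_cells {n : ℕ} (z zb : Fin n → ℝ) (w : Fin 7 → Fin n → ℝ)
    {Q : Set (ℝ × ℝ)} {ℓ : ℕ} (t : ℕ → ℝ) (m : ℕ) {lo hi : ℝ}
    (hlo : t 0 ≤ lo) (hhi : hi ≤ t m)
    (hcell : ∀ i < m, ∀ p ∈ Q, ∀ Δ ∈ Ico (t i) (t (i + 1)), (ofPoints z zb w).VectorPositive p.1 p.2 Δ ℓ) :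
    ∀ p ∈ Q, ∀ Δ : ℝ, lo ≤ Δ → Δ < hi → (ofPoints z zb w).VectorPositive p.1 p.2 Δ ℓ :=
  fun p hp Δ h1 h2 => (vectorPositive_ofPoints_iff z zb w p.1 p.2 Δ ℓ).2
    (oddPositive_of_cells z zb (oddWeights w) t m hlo hhi
      (fun i hi' p' hp' Δ' hΔ' => (vectorPositive_ofPoints_iff z zb w p'.1 p'.2 Δ' ℓ).1
        (hcell i hi' p' hp' Δ' hΔ')) p hp Δ h1 h2)

/-- **The item `spinning_V` of one spin from a cell list**: cells covering `[ℓ+1, E₀)` give the light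
`V` rows of spin `ℓ ≠ 0`. [cite: KosPolandSimmonsDuffinVichi2015, §2.2 (functional conditions)] -/
theorem spinning_V_of_cells {n : ℕ} (z zb : Fin n → ℝ) (w : Fin 7 → Fin n → ℝ)
    {Q : Set (ℝ × ℝ)} {ℓ : ℕ} {E₀ : ℝ} (t : ℕ → ℝ) (m : ℕ)
    (hlo : t 0 ≤ (ℓ : ℝ) + 1) (hhi : E₀ ≤ t m)
    (hcell : ∀ i < m, ∀ p ∈ Q, ∀ Δ ∈ Ico (t i) (t (i + 1)), (ofPoints z zb w).VectorPositive p.1 p.2 Δ ℓ) :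
    ∀ p ∈ Q, ∀ Δ : ℝ, (ℓ : ℝ) + 1 ≤ Δ → Δ < E₀ → (ofPoints z zb w).VectorPositive p.1 p.2 Δ ℓ :=
  vectorPositive_of_cells z zb w t m hlo hhi hcell

/-- **The item `scalar_V` from a cell list**: cells covering `[max(Δ_V^*, 1/2), E₀)` give the light
scalar `V` rows above the gap. [cite: KosPolandSimmonsDuffinVichi2015, §2.2 (functional conditions)] -/
theorem scalar_V_of_cells {n : ℕ} (z zb : Fin n → ℝ) (w : Fin 7 → Fin n → ℝ)
    {Q : Set (ℝ × ℝ)} {ΔVstar E₀ : ℝ} (t : ℕ → ℝ) (m : ℕ)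
    (hlo : t 0 ≤ max ΔVstar (1 / 2)) (hhi : E₀ ≤ t m)
    (hcell : ∀ i < m, ∀ p ∈ Q, ∀ Δ ∈ Ico (t i) (t (i + 1)), (ofPoints z zb w).VectorPositive p.1 p.2 Δ 0) :
    ∀ p ∈ Q, ∀ Δ : ℝ, ΔVstar ≤ Δ → 1 / 2 ≤ Δ → Δ < E₀ → (ofPoints z zb w).VectorPositive p.1 p.2 Δ 0 :=
  fun p hp Δ hg hb hE => vectorPositive_of_cells z zb w t m le_rfl hhi hcell p hp Δ
    (hlo.trans (max_le hg hb)) hE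

end ArchipelagoFunctional

end Literature.MathematicalPhysics.QuantumFieldTheory.ONArchipelagoSystem
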